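import Summits.ResolutionOfSingularities.ResolutionOfSingularities.Theorems.EquisingularLiftEquisingularLiftNatNestedSectionInModels
import Summits.ResolutionOfSingularities.ResolutionOfSingularities.Theorems.EquisingularLiftEquisingularLiftNatDirZeroDefs
import Literature.AlgebraicGeometry.Resolution.AlterationsStrictTransformModel
import HarnessLib

/-!
# EL♮(3), D17 engine brick (n2): the Hensel section INSIDE one member's model, through a given closed point

Sub-problem `ResolutionOfSingularities`, crux `EquisingularLiftNatThree` (`stmt-ResolutionOfSingularities-20148`), line W4.5(b) (L1 RESCUE),
desk R81-PRE / R83 «STAGE-0 TOWER BOOKKEEPING» (D17), brick **(n2) CONSTRAINED POINT-LIFT, one member** — the supply lemma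
res-L1-w45b-stub-4's `Tower.invB₄_ptRegStep₅` consumes by name in its one-through-member arm (the two-member arm is res-L1-w45b-lead-2's
✓ `Tower.exists_joint_section_of_coneWitness`).

Statement. Let `σ ≫ q : X → Spec O` be separated and locally of finite type, `jG : G ↪ X` its special fibre (model square `hsq` over
`Spec θ`, `θ : O ↠ k`), and `𝓕` an ideal sheaf on `X` — a member's MODEL — with `V(𝓕)` regular, `V(𝓕) → Spec O` flat and reduced trace
`𝓕·𝒪_G = 𝓘⟨F⟩`. If the closed point `y ∈ F` is a regular point of the reduced curve/surface `F̃ = redSub G F`, then there is a section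
`ỹ : Spec O → X` of `σ ≫ q` through `jG y` lying INSIDE `V(𝓕)`, i.e. `𝓕 ≤ ker ỹ`; moreover `ỹ` is a closed immersion, `V(ker ỹ) ≅ Spec O` is
regular, `supp (ker ỹ) = range ỹ` and `ỹ(𝔪)` is a closed point.

Proof (≈ 25 lines, the «HPT on-the-host block» of ✓ `TCPlus.hostedPointStep_of_letterDatum` with `𝓛 := 𝓕`): the special fibre
`V(𝓕·𝒪_G) → V(𝓕)` is a model square (Mathlib `isPullback_of_isClosedImmersion` pasted with `hsq`); `V(𝓕·𝒪_G) = F̃` literally after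
rewriting `he1`; the nested Hensel section is ✓ `exists_nested_section_closedImmersion` [cite: Grothendieck1967, Thm. 18.5.17]; and
`𝓕 = ker (V(𝓕) ↪ X) ≤ ker ỹ` because `range ỹ ⊆ V(𝓕)` (`IsClosedImmersion.ker_le_ker_of_range_subset`, `Spec O` reduced).

[OURS · res-L1-w45b-stub-2 g20 · counted 0 · EL♮(3) NOT proved.]
-/

set_option linter.dupNamespace false -- mandated namespace `Summit.<Summit>.<Problem>` of this single-conjunct summit
set_option linter.overlappingInstances false -- signatures carry `[IsDomain O] [IsDiscreteValuationRing O]`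

open CategoryTheory CategoryTheory.Limits AlgebraicGeometry TopologicalSpace Topology IsLocalRing
open Literature.AlgebraicGeometry.Resolution
open AlgebraicGeometry.Scheme.IdealSheafData
open Summit.ResolutionOfSingularities.ResolutionOfSingularities.Theses.EquisingularLift.Split
open Summit.ResolutionOfSingularities.ResolutionOfSingularities.Cruxes.EquisingularLift.StrataSplit

namespace Summit.ResolutionOfSingularities.ResolutionOfSingularities.Cruxes.EquisingularLiftNat.Sections

/-- ★ **(n2) THE SECTION INSIDE ONE MEMBER'S MODEL, full letter.** For a separated, locally-of-finite-type `σ ≫ q : X → Spec O` with special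
fibre `jG : G ↪ X` (model square over `Spec θ`), a model `𝓕` with `V(𝓕)` regular and `O`-flat and reduced trace `𝓕·𝒪_G = 𝓘⟨F⟩`, and a closed
point `y ∈ F` at which `F̃` is regular: a section `ỹ` of `σ ≫ q` through `jG y` with `𝓕 ≤ ker ỹ`, a closed immersion, `V(ker ỹ)` regular,
`range ỹ ⊆ V(𝓕)`, `supp (ker ỹ) = range ỹ`, `ỹ(𝔪)` closed. [cite: Grothendieck1967, Thm. 18.5.17] [OURS · D17 brick (n2); EL♮(3) NOT proved.] -/
theorem Tower.exists_section_on_memberModel' (O : Type) [CommRing O] [IsDomain O] [IsDiscreteValuationRing O]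
    [IsAdicComplete (maximalIdeal O) O] [IsAlgClosed (ResidueField O)] (k : Type) [Field k]
    (θ : O →+* k) (hθ : Function.Surjective θ) {X G P : Scheme.{0}} (σ : X ⟶ P) (q : P ⟶ Spec (.of O))
    [IsSeparated (σ ≫ q)] [LocallyOfFiniteType (σ ≫ q)]
    (jG : G ⟶ X) (tG : G ⟶ Spec (.of k)) (hsq : IsPullback jG tG (σ ≫ q) (Spec.map (CommRingCat.ofHom θ)))
    (𝓕 : X.IdealSheafData) (he3 : Scheme.IsRegular 𝓕.subscheme) (hfl : Flat (𝓕.subschemeι ≫ σ ≫ q))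
    {F : Set G} (hF : IsClosed F) (he1 : 𝓕.comap jG = vanishingIdeal ⟨F, hF⟩)
    (y : G) (hyF : y ∈ F) (hyc : IsClosed ({y} : Set G))
    (hFreg : ∀ e : ↥(redSub G F hF), (redSubι G F hF e : G) = y → IsRegularLocalRing ((redSub G F hF).presheaf.stalk e)) :
    ∃ s : Spec (.of O) ⟶ X, s ≫ σ ≫ q = 𝟙 _ ∧ s (closedPoint O) = jG y ∧ 𝓕 ≤ s.ker ∧ IsClosedImmersion s ∧
      Scheme.IsRegular s.ker.subscheme ∧ Set.range s.base ⊆ Set.range 𝓕.subschemeι.base ∧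
      (s.ker.support : Set X) = Set.range s.base ∧ IsClosed ({s (closedPoint O)} : Set X) := by
  -- (0) `F̃ = V(𝓕·𝒪_G)` literally, after rewriting `he1`: regularity of the trace at the points over `y`
  have hFreg' : ∀ (I : G.IdealSheafData), I = vanishingIdeal ⟨F, hF⟩ →
      ∀ e : ↥I.subscheme, (I.subschemeι e : G) = y → IsRegularLocalRing (I.subscheme.presheaf.stalk e) := by
    rintro I rfl e he
    exact hFreg e he
  -- (1) the special fibre `V(𝓕·𝒪_G) → V(𝓕)` as a model square
  let ιW := 𝓕.subschemeι
  let iX := (𝓕.comap jG).subschemeι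
  let jW : (𝓕.comap jG).subscheme ⟶ 𝓕.subscheme := Scheme.IdealSheafData.subschemeMap (𝓕.comap jG) 𝓕 jG (𝓕.le_map_comap jG)
  have hjW : jW ≫ ιW = iX ≫ jG := Scheme.IdealSheafData.subschemeMap_subschemeι _ _ _ _
  have hsq1 : IsPullback iX jW jG ιW :=
    isPullback_of_isClosedImmersion iX ιW jW jG hjW.symm
      (by rw [Scheme.IdealSheafData.ker_subschemeι, Scheme.IdealSheafData.ker_subschemeι])
  have hsqW : IsPullback jW (iX ≫ tG) (ιW ≫ σ ≫ q) (Spec.map (CommRingCat.ofHom θ)) := hsq1.flip.paste_vert hsq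
  -- (2) the point of `F̃ = V(𝓕·𝒪_G)` under `y`
  have hysupp : y ∈ ((𝓕.comap jG).support : Set G) := by
    rw [he1, Scheme.IdealSheafData.coe_support_vanishingIdeal]; exact hyF
  obtain ⟨xW, hxW⟩ : y ∈ Set.range iX := by rw [Scheme.IdealSheafData.range_subschemeι]; exact hysupp
  have hxWcl : IsClosed ({xW} : Set (𝓕.comap jG).subscheme) := by
    rw [iX.isClosedEmbedding.isClosed_iff_image_isClosed, Set.image_singleton, hxW]; exact hyc
  have hregW : IsRegularLocalRing ((𝓕.subscheme).presheaf.stalk (jW xW)) := he3 _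
  have hxreg : IsRegularLocalRing ((𝓕.comap jG).subscheme.presheaf.stalk xW) := hFreg' _ he1 xW hxW
  -- (3) the nested Hensel section inside `V(𝓕)`
  haveI : Flat (ιW ≫ σ ≫ q) := hfl
  haveI : LocallyOfFinitePresentation (ιW ≫ σ ≫ q) := locallyOfFinitePresentation_of_isLocallyNoetherian' _
  obtain ⟨s, hs, hsx, hsci, hsreg, hrange, hsupp, hscl⟩ :=
    exists_nested_section_closedImmersion O k θ hθ X 𝓕.subscheme (𝓕.comap jG).subscheme (σ ≫ q) ιW jW (iX ≫ tG) hsqW xW hxWcl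
      hregW hxreg
  have hss₀ : s (closedPoint O) = jG y := by
    rw [hsx, ← Scheme.Hom.comp_apply, hjW, Scheme.Hom.comp_apply, hxW]
  -- the model contains the section
  have hle : 𝓕 ≤ s.ker := by
    have h := Literature.AlgebraicGeometry.Resolution.IsClosedImmersion.ker_le_ker_of_range_subset ιW s hrange
    rwa [Scheme.IdealSheafData.ker_subschemeι] at h
  refine ⟨s, hs, hss₀, hle, hsci, hsreg, hrange, hsupp, ?_⟩
  rw [hss₀] at hscl
  rw [hss₀]
  exact hscl

/-- ★ **(n2) THE SECTION INSIDE ONE MEMBER'S MODEL** — the three-clause letter res-L1-w45b-stub-4's `Tower.invB₄_ptRegStep₅` consumes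
(bus 2026-08-29 13:01Z): under the hypotheses of `Tower.exists_section_on_memberModel'`, `∃ ỹ, ỹ ≫ σ ≫ q = 𝟙 ∧ ỹ(𝔪) = jG y ∧ 𝓕 ≤ ker ỹ`.
[cite: Grothendieck1967, Thm. 18.5.17] [OURS · D17 brick (n2); EL♮(3) NOT proved.] -/
theorem Tower.exists_section_on_memberModel (O : Type) [CommRing O] [IsDomain O] [IsDiscreteValuationRing O]
    [IsAdicComplete (maximalIdeal O) O] [IsAlgClosed (ResidueField O)] (k : Type) [Field k]
    (θ : O →+* k) (hθ : Function.Surjective θ) {X G P : Scheme.{0}} (σ : X ⟶ P) (q : P ⟶ Spec (.of O))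
    [IsSeparated (σ ≫ q)] [LocallyOfFiniteType (σ ≫ q)]
    (jG : G ⟶ X) (tG : G ⟶ Spec (.of k)) (hsq : IsPullback jG tG (σ ≫ q) (Spec.map (CommRingCat.ofHom θ)))
    (𝓕 : X.IdealSheafData) (he3 : Scheme.IsRegular 𝓕.subscheme) (hfl : Flat (𝓕.subschemeι ≫ σ ≫ q))
    {F : Set G} (hF : IsClosed F) (he1 : 𝓕.comap jG = vanishingIdeal ⟨F, hF⟩)
    (y : G) (hyF : y ∈ F) (hyc : IsClosed ({y} : Set G))
    (hFreg : ∀ e : ↥(redSub G F hF), (redSubι G F hF e : G) = y → IsRegularLocalRing ((redSub G F hF).presheaf.stalk e)) :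
    ∃ s : Spec (.of O) ⟶ X, s ≫ σ ≫ q = 𝟙 _ ∧ s (closedPoint O) = jG y ∧ 𝓕 ≤ s.ker := by
  obtain ⟨s, hs, hss₀, hle, -⟩ :=
    Tower.exists_section_on_memberModel' O k θ hθ σ q jG tG hsq 𝓕 he3 hfl hF he1 y hyF hyc hFreg
  exact ⟨s, hs, hss₀, hle⟩

end Summit.ResolutionOfSingularities.ResolutionOfSingularities.Cruxes.EquisingularLiftNat.Sections
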